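import Literature.Analysis.FluidPDE.PassiveScalarDiagMildSource
import HarnessLib

/-!
# Mild (Duhamel) formulation of the passive scalar equation with constant diagonal diffusion and
  bounded drift: the source Duhamel term of the FORCED equation

Analysis/FluidPDE proof-support file (everything proved). For the forced equation
`∂ₜθ + div(uθ) = κ ∑ᵢ aᵢ ∂ᵢ∂ᵢθ + s` with a source `s ∈ L²((0,T) × T^d)` (`Torus.SourceL2`,
`PassiveScalarDiagMildSource`) the mild formulation mode by mode reads
`θ̂ₖ(t) = e^{-νₖt} θ̂₀(k) + ∫₀ᵗ e^{-νₖ(t-τ)} ŝ(τ)(k) dτ - ∫₀ᵗ e^{-νₖ(t-τ)} N(θ)(τ)(k) dτ`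
(Pazy 1983, Ch. 4 §4.2, Def. 2.3 and the inhomogeneous problem Cor. 2.5). This file treats the new,
`θ`-independent term: the (damped) **source Duhamel coefficient**
`S^λ(s)(t)(k) = ∫_{(0,t]} e^{-(νₖ+λ)(t-τ)} ŝ(τ)(k) dτ` (`Torus.sourceDuhamel`):

* `S^λ(s)(·)(k)` is continuous on `[0,T]`, conjugate symmetric, vanishes at `t = 0`;
* the `ℓ²` bound `∑_{k∈F} |S^λ(s)(t)(k)|² ≤ E_s/(2λ)` (Cauchy–Schwarz in time:
  `∫₀ᵗ e^{-2(νₖ+λ)(t-τ)}dτ ≤ 1/(2λ)`), so `S^λ(s)` is an admissible family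
  (`Torus.IsMildCoeff T √(E_s/(2λ)) (sourceDuhamel κ a λ s)`) — a legitimate free term for the
  Picard iteration of `PassiveScalarDiagMildPicard`;
* uniformly small frequency tails (from the time-integrated slice tails of the source);
* undamping: `S⁰(s)(t) = e^{λt} S^λ(e^{-λ·}s)(t)`.

## References

* A. Pazy, *Semigroups of Linear Operators and Applications to PDE*, Springer 1983, Ch. 4 §4.2,
  (2.3), Def. 2.3, Cor. 2.5 (inhomogeneous initial value problem, mild solution).
* L. C. Evans, *Partial Differential Equations*, 2nd ed. (AMS 2010), §7.1.2 (energy estimates with `f ∈ L²(0,T;L²)`).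
* L. Grafakos, *Classical Fourier Analysis*, 3rd ed. (2014), Prop. 3.2.6 (4), Prop. 3.2.7 (3).
-/

noncomputable section

open MeasureTheory TopologicalSpace Set Function Filter UnitAddTorus
open _root_.Topology
open scoped ENNReal NNReal InnerProductSpace ComplexConjugate

namespace Literature.Analysis.FluidPDE

namespace Torus

open Literature.Analysis.FunctionSpaces.Torus Literature.Analysis.FunctionSpaces

variable {d : Type*} [Fintype d]

/-! ## The source Duhamel coefficient -/

section SourceDuhamel

variable {T Es κ lam : ℝ} {a : d → ℝ} {s : ℝ → UnitAddTorus d → ℝ}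

/-- The (exponentially damped) **source Duhamel coefficient**
`S^λ(s)(t)(k) = ∫_{(0,t]} e^{-(νₖ+λ)(t-τ)} ŝ(τ)(k) dτ` — the `k`-th Fourier mode of
`∫₀ᵗ e^{(t-τ)(κ∑aᵢ∂ᵢ∂ᵢ - λ)} s(τ) dτ`, the inhomogeneous term of the mild solution (Pazy 1983,
Ch. 4, (2.3) / Cor. 2.5); `λ = 0` is the undamped term. [cite: Pazy1983, Ch. 4 §4.2, (2.3) and Def. 2.3 (mild solution), p. 106] -/
def sourceDuhamel (κ : ℝ) (a : d → ℝ) (lam : ℝ) (s : ℝ → UnitAddTorus d → ℝ) (t : ℝ) (k : d → ℤ) : ℂ :=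
  ∫ τ in Ioc 0 t, ((Real.exp (-((diagRate κ a k + lam) * (t - τ))) : ℝ) : ℂ) * testCoeff s τ k

/-- Unfolding `sourceDuhamel`. [cite: Pazy1983, Ch. 4 §4.2, (2.3) and Def. 2.3 (mild solution), p. 106] -/
theorem sourceDuhamel_apply (κ : ℝ) (a : d → ℝ) (lam : ℝ) (s : ℝ → UnitAddTorus d → ℝ) (t : ℝ) (k : d → ℤ) :
    sourceDuhamel κ a lam s t k =
      ∫ τ in Ioc 0 t, ((Real.exp (-((diagRate κ a k + lam) * (t - τ))) : ℝ) : ℂ) * testCoeff s τ k := rfl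

/-- At `t = 0` the source Duhamel coefficient vanishes (empty time interval). [cite: Pazy1983, Ch. 4 §4.2, (2.3) and Def. 2.3 (mild solution), p. 106] -/
theorem sourceDuhamel_time_zero (κ : ℝ) (a : d → ℝ) (lam : ℝ) (s : ℝ → UnitAddTorus d → ℝ) (k : d → ℤ) :
    sourceDuhamel κ a lam s 0 k = 0 := by
  rw [sourceDuhamel_apply, Ioc_self, Measure.restrict_empty, integral_zero_measure]

/-- Conjugate symmetry: `S^λ(s)(t)(-k) = conj (S^λ(s)(t)(k))` (`ν₋ₖ = νₖ`, real kernel, real source). [cite: Grafakos2014, Prop. 3.2.6 (4)] -/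
theorem sourceDuhamel_neg (κ : ℝ) (a : d → ℝ) (lam : ℝ) (s : ℝ → UnitAddTorus d → ℝ) (t : ℝ) (k : d → ℤ) :
    sourceDuhamel κ a lam s t (-k) = conj (sourceDuhamel κ a lam s t k) := by
  rw [sourceDuhamel_apply, sourceDuhamel_apply, ← integral_conj]
  refine integral_congr_ae (ae_of_all _ fun τ => ?_)
  dsimp only
  rw [map_mul, Complex.conj_ofReal, diagRate_neg, testCoeff_neg]

/-- **Factorisation of the kernel**: `S^λ(s)(t)(k) = e^{-(νₖ+λ)t} ∫_{(0,t]} e^{(νₖ+λ)τ} ŝ(τ)(k) dτ`. [cite: Pazy1983, Ch. 4 §4.2, (2.3) and Def. 2.3 (mild solution), p. 106] -/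
theorem sourceDuhamel_eq_exp_mul_integral (κ : ℝ) (a : d → ℝ) (lam : ℝ) (s : ℝ → UnitAddTorus d → ℝ)
    (t : ℝ) (k : d → ℤ) :
    sourceDuhamel κ a lam s t k = ((Real.exp (-((diagRate κ a k + lam) * t)) : ℝ) : ℂ) *
      ∫ τ in Ioc 0 t, ((Real.exp ((diagRate κ a k + lam) * τ) : ℝ) : ℂ) * testCoeff s τ k := by
  rw [sourceDuhamel_apply, ← integral_const_mul]
  refine integral_congr_ae (ae_of_all _ fun τ => ?_)
  dsimp only
  rw [← mul_assoc, ← Complex.ofReal_mul, ← Real.exp_add]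
  congr 3
  ring

/-- The slice coefficients are integrable on `[0,T]` (null endpoints). [cite: Grafakos2014, Prop. 3.2.7 (3)] -/
theorem integrableOn_testCoeff_Icc (h : SourceL2 T s Es) (k : d → ℤ) :
    IntegrableOn (fun τ => testCoeff s τ k) (Icc 0 T) volume := by
  rw [integrableOn_Icc_iff_integrableOn_Ioo]
  exact integrable_testCoeff_source h k

/-- The exponentially weighted slice coefficients are integrable on `[0,T]`. [cite: Pazy1983, Ch. 4 §4.2, (2.3) and Def. 2.3 (mild solution), p. 106] -/
theorem integrableOn_exp_mul_testCoeff (h : SourceL2 T s Es) (c : ℝ) (k : d → ℤ) :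
    IntegrableOn (fun τ => ((Real.exp (c * τ) : ℝ) : ℂ) * testCoeff s τ k) (Icc 0 T) volume := by
  refine (integrableOn_testCoeff_Icc h k).bdd_mul (c := Real.exp (|c| * |T|))
    (Complex.continuous_ofReal.comp (Real.continuous_exp.comp (continuous_const.mul continuous_id))
      |>.aestronglyMeasurable) ?_
  filter_upwards [ae_restrict_mem measurableSet_Icc] with τ hτ
  rw [Complex.norm_real, Real.norm_of_nonneg (Real.exp_pos _).le, Real.exp_le_exp]
  calc c * τ ≤ |c * τ| := le_abs_self _
    _ = |c| * |τ| := abs_mul c τ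
    _ ≤ |c| * |T| := by
        refine mul_le_mul_of_nonneg_left ?_ (abs_nonneg c)
        rw [abs_of_nonneg hτ.1]
        exact hτ.2.trans (le_abs_self T)

/-- **The source Duhamel coefficient is continuous in time on `[0,T]`** at every frequency (a
continuous factor times the primitive of an integrable function). [cite: Pazy1983, Ch. 4 §4.2, (2.3) and Def. 2.3 (mild solution), p. 106] -/
theorem continuousOn_sourceDuhamel (h : SourceL2 T s Es) (k : d → ℤ) :
    ContinuousOn (fun t => sourceDuhamel κ a lam s t k) (Icc 0 T) := by
  have h1 : ContinuousOn (fun t => ∫ τ in Ioc 0 t,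
      ((Real.exp ((diagRate κ a k + lam) * τ) : ℝ) : ℂ) * testCoeff s τ k) (Icc 0 T) :=
    intervalIntegral.continuousOn_primitive (integrableOn_exp_mul_testCoeff h _ k)
  have h2 : Continuous fun t : ℝ => ((Real.exp (-((diagRate κ a k + lam) * t)) : ℝ) : ℂ) :=
    Complex.continuous_ofReal.comp (Real.continuous_exp.comp ((continuous_const.mul continuous_id).neg))
  refine (h2.continuousOn.mul h1).congr fun t _ => ?_
  exact sourceDuhamel_eq_exp_mul_integral κ a lam s t k

/-- The damped kernel times the slice coefficient is integrable on `(0,t]`, `t ≤ T`. [cite: Pazy1983, Ch. 4 §4.2, (2.3) and Def. 2.3 (mild solution), p. 106] -/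
theorem integrableOn_kernel_mul_testCoeff (h : SourceL2 T s Es) {t : ℝ} (ht : t ≤ T) (k : d → ℤ) :
    IntegrableOn (fun τ => ((Real.exp (-((diagRate κ a k + lam) * (t - τ))) : ℝ) : ℂ) * testCoeff s τ k)
      (Ioc 0 t) volume := by
  have h0 : IntegrableOn (fun τ => testCoeff s τ k) (Ioc 0 t) volume :=
    (integrableOn_testCoeff_Icc h k).mono_set (Ioc_subset_Icc_self.trans (Icc_subset_Icc_right ht))
  refine h0.bdd_mul (c := Real.exp (|diagRate κ a k + lam| * (|t| + |t|)))
    (Complex.continuous_ofReal.comp (Real.continuous_exp.comp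
      ((continuous_const.mul (continuous_const.sub continuous_id)).neg)) |>.aestronglyMeasurable) ?_
  filter_upwards [ae_restrict_mem measurableSet_Ioc] with τ hτ
  rw [Complex.norm_real, Real.norm_of_nonneg (Real.exp_pos _).le, Real.exp_le_exp]
  have hτ' : |τ| ≤ |t| := by
    rw [abs_of_nonneg hτ.1.le]
    exact hτ.2.trans (le_abs_self t)
  calc -((diagRate κ a k + lam) * (t - τ)) ≤ |(diagRate κ a k + lam) * (t - τ)| := neg_le_abs _
    _ = |diagRate κ a k + lam| * |t - τ| := abs_mul _ _
    _ ≤ |diagRate κ a k + lam| * (|t| + |t|) :=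
        mul_le_mul_of_nonneg_left ((abs_sub _ _).trans (add_le_add le_rfl hτ')) (abs_nonneg _)

/-- **Undamping the source term**: the undamped source Duhamel coefficient of `s` is `e^{λt}`
times the `λ`-damped one of the attenuated source `e^{-λτ}s(τ)`:
`S⁰(s)(t) = e^{λt} S^λ(e^{-λ·}s)(t)` (`e^{-νₖ(t-τ)} = e^{λt} e^{-(νₖ+λ)(t-τ)} e^{-λτ}`). [cite: Pazy1983, Ch. 4 §4.2, (2.3) and Def. 2.3 (mild solution), p. 106] -/
theorem sourceDuhamel_zero_eq_exp_mul (κ : ℝ) (a : d → ℝ) (lam : ℝ) (s : ℝ → UnitAddTorus d → ℝ)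
    (t : ℝ) (k : d → ℤ) :
    sourceDuhamel κ a 0 s t k = ((Real.exp (lam * t) : ℝ) : ℂ) *
      sourceDuhamel κ a lam (fun τ x => Real.exp (-(lam * τ)) * s τ x) t k := by
  rw [sourceDuhamel_apply, sourceDuhamel_apply, ← integral_const_mul]
  refine integral_congr_ae (ae_of_all _ fun τ => ?_)
  dsimp only
  rw [testCoeff_mul_left, ← mul_assoc, ← mul_assoc, ← Complex.ofReal_mul, ← Complex.ofReal_mul,
    ← Real.exp_add, ← Real.exp_add]
  congr 3
  ring

/-! ### The `ℓ²` bounds (Cauchy–Schwarz in time) -/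

omit [Fintype d] in
/-- Cauchy–Schwarz on a finite measure space (real line), squared form for nonnegative `L²` functions:
`(∫ φψ)² ≤ (∫ φ²)(∫ ψ²)`. [folklore] -/
private theorem sq_integral_mul_le_integral_sq_mul_integral_sq {μ : Measure ℝ} [IsFiniteMeasure μ] {φ ψ : ℝ → ℝ}
    (hφ : MemLp φ 2 μ) (hψ : MemLp ψ 2 μ) (hφ0 : 0 ≤ᵐ[μ] φ) (hψ0 : 0 ≤ᵐ[μ] ψ) :
    (∫ τ, φ τ * ψ τ ∂μ) ^ 2 ≤ (∫ τ, φ τ ^ 2 ∂μ) * (∫ τ, ψ τ ^ 2 ∂μ) := by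
  have hφ' : MemLp φ (ENNReal.ofReal 2) μ := by simpa using hφ
  have hψ' : MemLp ψ (ENNReal.ofReal 2) μ := by simpa using hψ
  have hH := integral_mul_le_Lp_mul_Lq_of_nonneg Real.HolderConjugate.two_two hφ0 hψ0 hφ' hψ'
  have e1 : ∫ τ, φ τ ^ (2 : ℝ) ∂μ = ∫ τ, φ τ ^ 2 ∂μ :=
    integral_congr_ae (ae_of_all _ fun τ => by dsimp only; rw [Real.rpow_two])
  have e2 : ∫ τ, ψ τ ^ (2 : ℝ) ∂μ = ∫ τ, ψ τ ^ 2 ∂μ :=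
    integral_congr_ae (ae_of_all _ fun τ => by dsimp only; rw [Real.rpow_two])
  rw [e1, e2] at hH
  have hA0 : 0 ≤ ∫ τ, φ τ ^ 2 ∂μ := integral_nonneg fun _ => sq_nonneg _
  have hB0 : 0 ≤ ∫ τ, ψ τ ^ 2 ∂μ := integral_nonneg fun _ => sq_nonneg _
  have hI0 : 0 ≤ ∫ τ, φ τ * ψ τ ∂μ := integral_nonneg_of_ae (by
    filter_upwards [hφ0, hψ0] with τ h1 h2; exact mul_nonneg h1 h2)
  rw [← Real.sqrt_eq_rpow, ← Real.sqrt_eq_rpow] at hH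
  calc (∫ τ, φ τ * ψ τ ∂μ) ^ 2 ≤ (Real.sqrt (∫ τ, φ τ ^ 2 ∂μ) * Real.sqrt (∫ τ, ψ τ ^ 2 ∂μ)) ^ 2 :=
        pow_le_pow_left₀ hI0 hH 2
    _ = (∫ τ, φ τ ^ 2 ∂μ) * (∫ τ, ψ τ ^ 2 ∂μ) := by
        rw [mul_pow, Real.sq_sqrt hA0, Real.sq_sqrt hB0]

/-- **The single-mode bound on the source Duhamel coefficient** (Cauchy–Schwarz in time): for
`κ ≥ 0`, `aᵢ ≥ 0`, `λ > 0` and `t ∈ [0,T]`,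
`|S^λ(s)(t)(k)|² ≤ (2λ)⁻¹ ∫₀ᵀ |ŝ(τ)(k)|² dτ`, using `∫_{(0,t]} e^{-2(νₖ+λ)(t-τ)} dτ ≤ 1/(2(νₖ+λ)) ≤ 1/(2λ)`. [cite: Evans2010, §7.1.2 Thm. 2 (energy estimates), with Pazy1983 Ch. 4 §4.2 (2.3)] -/
theorem norm_sq_sourceDuhamel_le (h : SourceL2 T s Es) (hκ : 0 ≤ κ) (ha : ∀ i, 0 ≤ a i) (hlam : 0 < lam)
    {t : ℝ} (ht : t ∈ Icc 0 T) (k : d → ℤ) :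
    ‖sourceDuhamel κ a lam s t k‖ ^ 2 ≤ (2 * lam)⁻¹ * ∫ τ in Ioo 0 T, ‖testCoeff s τ k‖ ^ 2 := by
  set μ : Measure ℝ := (volume : Measure ℝ).restrict (Ioc 0 t) with hμ
  haveI : IsFiniteMeasure μ := by rw [hμ]; exact isFiniteMeasure_restrict.2 measure_Ioc_lt_top.ne
  have hc0 : 0 < diagRate κ a k + lam := add_pos_of_nonneg_of_pos (diagRate_nonneg hκ ha k) hlam
  have hcl : lam ≤ diagRate κ a k + lam := le_add_of_nonneg_left (diagRate_nonneg hκ ha k)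
  have hle : μ ≤ (volume : Measure ℝ).restrict (Ioo 0 T) := by
    rw [hμ, ← Measure.restrict_congr_set (Ioo_ae_eq_Ioc (μ := (volume : Measure ℝ)))]
    exact Measure.restrict_mono (Ioo_subset_Ioo_right ht.2) le_rfl
  -- the two factors
  set φ : ℝ → ℝ := fun τ => Real.exp (-((diagRate κ a k + lam) * (t - τ))) with hφ
  set ψ : ℝ → ℝ := fun τ => ‖testCoeff s τ k‖ with hψ
  have hφc : Continuous φ := by simp only [hφ]; fun_prop
  -- (1) `‖S‖ ≤ ∫ φ ψ`
  have h1 : ‖sourceDuhamel κ a lam s t k‖ ≤ ∫ τ, φ τ * ψ τ ∂μ := by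
    rw [sourceDuhamel_apply]
    refine (norm_integral_le_integral_norm _).trans (le_of_eq ?_)
    refine integral_congr_ae (ae_of_all _ fun τ => ?_)
    simp only [hφ, hψ, norm_mul, Complex.norm_real, Real.norm_of_nonneg (Real.exp_pos _).le]
  -- (2) `ψ ∈ L²(μ)`
  have hψi : Integrable (fun τ => ψ τ ^ 2) μ := (integrable_sq_norm_testCoeff h k).mono_measure hle
  have hψmeas : AEStronglyMeasurable ψ μ :=
    ((integrable_testCoeff_source h k).mono_measure hle).aestronglyMeasurable.norm
  have hψm : MemLp ψ 2 μ := (memLp_two_iff_integrable_sq hψmeas).2 hψi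
  -- (3) `φ ∈ L²(μ)`, `0 < φ ≤ 1` on `(0,t]`
  have hφle : ∀ᵐ τ ∂μ, ‖φ τ‖ ≤ 1 := by
    rw [hμ]
    filter_upwards [ae_restrict_mem measurableSet_Ioc] with τ hτ
    rw [Real.norm_of_nonneg (Real.exp_pos _).le, Real.exp_le_one_iff, neg_nonpos]
    exact mul_nonneg hc0.le (by linarith [hτ.2])
  have hφm : MemLp φ 2 μ := (memLp_top_of_bound hφc.aestronglyMeasurable 1 hφle).mono_exponent le_top
  -- (4) Cauchy–Schwarz
  have hCS := sq_integral_mul_le_integral_sq_mul_integral_sq hφm hψm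
    (ae_of_all _ fun τ => (Real.exp_pos _).le) (ae_of_all _ fun τ => norm_nonneg _)
  -- (5) the kernel integral
  have hφ2 : ∫ τ, φ τ ^ 2 ∂μ ≤ (2 * lam)⁻¹ := by
    have e : (fun τ => φ τ ^ 2) = fun τ => Real.exp (-((2 * (diagRate κ a k + lam)) * (t - τ))) := by
      funext τ; simp only [hφ]; rw [sq, ← Real.exp_add]; congr 1; ring
    rw [e, hμ]
    calc ∫ τ in Ioc 0 t, Real.exp (-((2 * (diagRate κ a k + lam)) * (t - τ))) ≤ (2 * (diagRate κ a k + lam))⁻¹ :=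
          integral_Ioc_exp_neg_mul_sub_le (by positivity)
      _ ≤ (2 * lam)⁻¹ := by gcongr
  -- (6) the coefficient integral
  have hψ2 : ∫ τ, ψ τ ^ 2 ∂μ ≤ ∫ τ in Ioo 0 T, ‖testCoeff s τ k‖ ^ 2 :=
    integral_mono_measure hle (ae_of_all _ fun τ => sq_nonneg _) (integrable_sq_norm_testCoeff h k)
  have hI0 : 0 ≤ ∫ τ in Ioo 0 T, ‖testCoeff s τ k‖ ^ 2 := integral_nonneg fun _ => sq_nonneg _
  have hA0 : 0 ≤ ∫ τ, φ τ ^ 2 ∂μ := integral_nonneg fun _ => sq_nonneg _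
  calc ‖sourceDuhamel κ a lam s t k‖ ^ 2 ≤ (∫ τ, φ τ * ψ τ ∂μ) ^ 2 := pow_le_pow_left₀ (norm_nonneg _) h1 2
    _ ≤ (∫ τ, φ τ ^ 2 ∂μ) * (∫ τ, ψ τ ^ 2 ∂μ) := hCS
    _ ≤ (2 * lam)⁻¹ * ∫ τ in Ioo 0 T, ‖testCoeff s τ k‖ ^ 2 :=
        mul_le_mul hφ2 hψ2 (integral_nonneg fun _ => sq_nonneg _) (by positivity)

/-- **The bound summed over a finite frequency set**:
`∑_{k∈F} |S^λ(s)(t)(k)|² ≤ (2λ)⁻¹ ∫₀ᵀ ∑_{k∈F} |ŝ(τ)(k)|² dτ`. [cite: Evans2010, §7.1.2 Thm. 2 (energy estimates), with Pazy1983 Ch. 4 §4.2 (2.3)] -/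
theorem sum_norm_sq_sourceDuhamel_le (h : SourceL2 T s Es) (hκ : 0 ≤ κ) (ha : ∀ i, 0 ≤ a i) (hlam : 0 < lam)
    {t : ℝ} (ht : t ∈ Icc 0 T) (F : Finset (d → ℤ)) :
    ∑ k ∈ F, ‖sourceDuhamel κ a lam s t k‖ ^ 2 ≤
      (2 * lam)⁻¹ * ∫ τ in Ioo 0 T, ∑ k ∈ F, ‖testCoeff s τ k‖ ^ 2 := by
  calc ∑ k ∈ F, ‖sourceDuhamel κ a lam s t k‖ ^ 2
      ≤ ∑ k ∈ F, (2 * lam)⁻¹ * ∫ τ in Ioo 0 T, ‖testCoeff s τ k‖ ^ 2 :=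
        Finset.sum_le_sum fun k _ => norm_sq_sourceDuhamel_le h hκ ha hlam ht k
    _ = (2 * lam)⁻¹ * ∫ τ in Ioo 0 T, ∑ k ∈ F, ‖testCoeff s τ k‖ ^ 2 := by
        rw [← Finset.mul_sum, integral_finsetSum _ fun k _ => integrable_sq_norm_testCoeff h k]

/-- **The `ℓ²` bound of the source Duhamel term**: `∑_{k∈F} |S^λ(s)(t)(k)|² ≤ E_s/(2λ)` for every
`t ∈ [0,T]` and every finite `F` — the source term is bounded in `L^∞_t ℓ²_k` by
`‖s‖_{L²_{t,x}}/√(2λ)`. [cite: Evans2010, §7.1.2 Thm. 2 (energy estimates), with Pazy1983 Ch. 4 §4.2 (2.3)] -/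
theorem sum_norm_sq_sourceDuhamel_le_const (h : SourceL2 T s Es) (hκ : 0 ≤ κ) (ha : ∀ i, 0 ≤ a i)
    (hlam : 0 < lam) {t : ℝ} (ht : t ∈ Icc 0 T) (F : Finset (d → ℤ)) :
    ∑ k ∈ F, ‖sourceDuhamel κ a lam s t k‖ ^ 2 ≤ Es / (2 * lam) := by
  refine (sum_norm_sq_sourceDuhamel_le h hκ ha hlam ht F).trans ?_
  rw [div_eq_inv_mul]
  exact mul_le_mul_of_nonneg_left (integral_sum_sq_norm_testCoeff_le h F) (by positivity)

/-- The finite `ℓ²` norms of the source Duhamel term: `l2F F (S^λ(s)(t)) ≤ √(E_s/(2λ))`. [cite: Evans2010, §7.1.2 Thm. 2 (energy estimates), with Pazy1983 Ch. 4 §4.2 (2.3)] -/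
theorem l2F_sourceDuhamel_le (h : SourceL2 T s Es) (hκ : 0 ≤ κ) (ha : ∀ i, 0 ≤ a i) (hlam : 0 < lam)
    {t : ℝ} (ht : t ∈ Icc 0 T) (F : Finset (d → ℤ)) :
    l2F F (sourceDuhamel κ a lam s t) ≤ Real.sqrt (Es / (2 * lam)) := by
  rw [l2F_apply]
  exact Real.sqrt_le_sqrt (sum_norm_sq_sourceDuhamel_le_const h hκ ha hlam ht F)

/-- **The source Duhamel term is an admissible free term**: continuous coordinates on `[0,T]`,
finite `ℓ²` norms bounded by `√(E_s/(2λ))`, conjugate symmetric (`Torus.IsMildCoeff`). [cite: Pazy1983, Ch. 4 §4.2, Cor. 2.5 (inhomogeneous problem), p. 107] -/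
theorem isMildCoeff_sourceDuhamel (h : SourceL2 T s Es) (hκ : 0 ≤ κ) (ha : ∀ i, 0 ≤ a i) (hlam : 0 < lam) :
    IsMildCoeff T (Real.sqrt (Es / (2 * lam))) (sourceDuhamel κ a lam s) :=
  ⟨fun k => continuousOn_sourceDuhamel h k, fun _ ht F => l2F_sourceDuhamel_le h hκ ha hlam ht F,
    fun t _ k => sourceDuhamel_neg κ a lam s t k⟩

/-! ### Uniformly small tails -/

/-- **Tail bound for the source Duhamel term**, uniform in `t ∈ [0,T]` and in the finite set `F`:
`∑_{k ∈ F \ F₀} |S^λ(s)(t)(k)|² ≤ (2λ)⁻¹ ∫₀ᵀ sourceTail(F₀)`. [cite: Evans2010, §7.1.2 Thm. 2 (energy estimates), with Pazy1983 Ch. 4 §4.2 (2.3)] -/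
theorem sum_sdiff_norm_sq_sourceDuhamel_le (h : SourceL2 T s Es) (hκ : 0 ≤ κ) (ha : ∀ i, 0 ≤ a i)
    (hlam : 0 < lam) {t : ℝ} (ht : t ∈ Icc 0 T) (F F₀ : Finset (d → ℤ)) :
    ∑ k ∈ F \ F₀, ‖sourceDuhamel κ a lam s t k‖ ^ 2 ≤ (2 * lam)⁻¹ * ∫ τ in Ioo 0 T, sourceTail s F₀ τ := by
  refine (sum_norm_sq_sourceDuhamel_le h hκ ha hlam ht (F \ F₀)).trans ?_
  refine mul_le_mul_of_nonneg_left ?_ (by positivity)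
  refine integral_mono_ae (integrable_finsetSum _ fun k _ => integrable_sq_norm_testCoeff h k)
    (integrable_sourceTail h F₀) ?_
  filter_upwards [ae_sum_sdiff_sq_norm_testCoeff_le_sourceTail h F₀] with τ hτ
  exact hτ F

/-- **Uniform tail smallness**, quantified: for every `ε > 0` there is `N` with
`∑_{k ∈ F \ freqBall N} |S^λ(s)(t)(k)|² ≤ ε` for all `t ∈ [0,T]` and all finite `F`. [cite: Evans2010, §7.1.2 Thm. 2 (energy estimates), with Pazy1983 Ch. 4 §4.2 (2.3)] -/
theorem exists_sum_sdiff_norm_sq_sourceDuhamel_le [DecidableEq d] (h : SourceL2 T s Es) (hκ : 0 ≤ κ) (ha : ∀ i, 0 ≤ a i)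
    (hlam : 0 < lam) {ε : ℝ} (hε : 0 < ε) :
    ∃ N : ℕ, ∀ t ∈ Icc 0 T, ∀ F : Finset (d → ℤ),
      ∑ k ∈ F \ freqBall N, ‖sourceDuhamel κ a lam s t k‖ ^ 2 ≤ ε := by
  have hl := (tendsto_integral_sourceTail h).const_mul (2 * lam)⁻¹
  rw [mul_zero] at hl
  obtain ⟨N, hN⟩ := (hl.eventually (gt_mem_nhds hε)).exists
  exact ⟨N, fun t ht F => (sum_sdiff_norm_sq_sourceDuhamel_le h hκ ha hlam ht F (freqBall N)).trans hN.le⟩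

end SourceDuhamel

end Torus

end Literature.Analysis.FluidPDE

end
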